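import Mathlib
import HarnessLib
import Literature.GroupTheory.CombinatorialGroupTheory.SignedHurwitzAction
import Literature.GroupTheory.CombinatorialGroupTheory.SignedHurwitzStabilisation
import Literature.GroupTheory.CombinatorialGroupTheory.SignedHurwitzTravel
import Literature.GroupTheory.CombinatorialGroupTheory.SignedHurwitzExchange

/-!
# Stub `stub_exchange` of line `modp-braid-orbits` for crux `ConvexBisection.AcyclicBisectionExists`
(item stmt-SmoothPoincare4-10508, route route-SmoothPoincare4-ConvexBisection)

The EXCHANGE ENGINE of the one-word model (letters = classes of vanishing cycles in
`H₁(F_{g,1}; ℤ) = ℤ^{2g}` with chirality signs, pairing `ω = stdSymp ℤ g`; moves = signed Hurwitz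
moves and stabilisation-pair moves, packaged as `Reach`).

**Statement (`stub_exchange`).** An integral signed word with `4g` letters, `2g` of them positive,
all classes non-zero and all classes spanning `ℚ^{2g}`, reaches (by `Reach`) a word of some genus
`g'` with `4g'` letters, `2g'` positive, whose POSITIVE classes span `ℚ^{2g'}`.

**Proof.** Induction on the corank `2g - rank U`, `U :=` the `ℚ`-span of the positive classes.
If `U ≠ ⊤`, one exchange raises the genus by `1` and the rank of `U` by `≥ 3`
(`exchange_step`):
* pigeonhole (`exists_redundant`): `2g` positive letters span a space of rank `< 2g`, so some
  positive `y` is redundant, `l = X ++ y :: Z` with `y ∈ span (positive classes of X ++ Z)`;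
* as all classes span but `U ≠ ⊤`, some NEGATIVE letter `w` has class `∉ U`;
* travel (`exists_adjacent`): Hurwitz moves bring a negative `w₁ ≡ w (mod U)` next to `y`,
  keeping every positive letter; the orbit keeps length, number of positives, non-vanishing of
  classes (`ω` is alternating) and the span of all classes;
* choose a primitive `c` with `ω(c, w₁) ≠ 0 ≠ ω(c, y)` and apply `reach_exchange`: one
  stabilisation pair at the cut `… w₁ ‖ y …` and two tilts, producing the positive classes
  `e + c - ω(w₁,c) w₁`, `f`, `y - ω(c,y)(e + c)` on top of the embedded old ones;
* counts are immediate; all classes still span (`eq_top_of_range_extendQ_le`); the rank of the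
  positive span grows by `≥ 3` (`finrank_add_three_le`, using `w₁ ∉ U ∋ y`), so the corank drops.
-/

noncomputable section

-- the prescribed namespace `Summit.<P>.<Sub>.…` duplicates `SmoothPoincare4` (P = Sub)
set_option linter.dupNamespace false

namespace Summit.SmoothPoincare4.SmoothPoincare4.Theorems.AcyclicBisectionExists.ModpBraidOrbits

open Literature.GroupTheory.CombinatorialGroupTheory.SignedHurwitz

namespace Exchange

variable {g : ℕ}

/-- The rational classes of sign `s` are the rational images of the integral ones. [folklore] -/
theorem classesOfSign_ratWord (l : IntWord g) (s : Bool) :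
    classesOfSign (ratWord l) s =
      (fun (v : Fin g ⊕ Fin g → ℤ) (i : Fin g ⊕ Fin g) => (v i : ℚ)) '' classesOfSign l s :=
  classesOfSign_mapWord _ l s

/-- The rational letters are the rational images of the integral ones. [folklore] -/
theorem letters_ratWord (l : IntWord g) :
    letters (ratWord l) = (fun (v : Fin g ⊕ Fin g → ℤ) (i : Fin g ⊕ Fin g) => (v i : ℚ)) '' letters l :=
  letters_mapWord _ l

/-- `dim ℚ^{2g} = 2g`. [folklore] -/
theorem finrank_eq (g : ℕ) : Module.finrank ℚ (Fin g ⊕ Fin g → ℚ) = 2 * g := by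
  rw [Module.finrank_fintype_fun_eq_card]
  simp [two_mul]

/-- **The exchange step.** If the positive classes of a word (with `4g` letters, `2g` positive,
non-zero classes, all classes spanning) do not span, one exchange reaches a word of genus
`g + 1` with the same invariants whose positive span has rank at least `3` more. [folklore] -/
theorem exchange_step (l : IntWord g) (hlen : l.length = 4 * g)
    (hbal : (l.filter (·.2)).length = 2 * g) (hnz : ∀ x ∈ l, x.1 ≠ 0)
    (hspan : Submodule.span ℚ (letters (ratWord l)) = ⊤)
    (hU : Submodule.span ℚ (classesOfSign (ratWord l) true) ≠ ⊤) :
    ∃ l' : IntWord (g + 1), Reach g l (g + 1) l' ∧ l'.length = 4 * (g + 1) ∧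
      (l'.filter (·.2)).length = 2 * (g + 1) ∧ (∀ x ∈ l', x.1 ≠ 0) ∧
      Submodule.span ℚ (letters (ratWord l')) = ⊤ ∧
      Module.finrank ℚ (Submodule.span ℚ (classesOfSign (ratWord l) true)) + 3 ≤
        Module.finrank ℚ (Submodule.span ℚ (classesOfSign (ratWord l') true)) := by
  rw [classesOfSign_ratWord] at hU ⊢
  rw [letters_ratWord] at hspan
  -- (a) a redundant positive letter `y = (yv, true)`
  have hlt : Module.finrank ℚ (Submodule.span ℚ ((fun (v : Fin g ⊕ Fin g → ℤ)
      (i : Fin g ⊕ Fin g) => (v i : ℚ)) '' classesOfSign l true)) < (l.filter (·.2)).length := by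
    rw [hbal, ← finrank_eq g]
    exact Submodule.finrank_lt hU
  obtain ⟨X, Z, ⟨yv, ys⟩, rfl, hy, hyU⟩ := exists_redundant (K := ℚ) _ l hlt
  dsimp only at hy hyU
  subst hy
  -- (b) a negative letter `w = (u, false)` with class outside `U`
  obtain ⟨u, hul, huU⟩ : ∃ u, (u, false) ∈ X ++ (yv, true) :: Z ∧ (fun i => (u i : ℚ)) ∉
      Submodule.span ℚ ((fun (v : Fin g ⊕ Fin g → ℤ) (i : Fin g ⊕ Fin g) => (v i : ℚ)) ''
        classesOfSign (X ++ (yv, true) :: Z) true) := by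
    by_contra! hall
    apply hU
    rw [eq_top_iff, ← hspan, Submodule.span_le]
    rintro _ ⟨v, ⟨s, hvs⟩, rfl⟩
    cases s
    · exact hall v hvs
    · exact Submodule.subset_span (Set.mem_image_of_mem _ hvs)
  have hmem : (u, false) ∈ X ++ Z := by
    simp only [List.mem_append, List.mem_cons, Prod.mk.injEq, Bool.false_eq_true, and_false,
      false_or] at hul
    exact List.mem_append.2 hul
  -- (c) travel: `w₁ = (wv, false)` next to `y`
  obtain ⟨A, C, ⟨wv, ws⟩, hO, hws, hcl, hf⟩ :=
    exists_adjacent (stdSymp ℤ g) X Z (yv, true) (u, false) rfl rfl hmem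
  dsimp only at hws hcl
  subst hws
  have hlen₁ : (A ++ (wv, false) :: (yv, true) :: C).length = 4 * g := hO.length_eq.trans hlen
  have hbal₁ : ((A ++ (wv, false) :: (yv, true) :: C).filter (·.2)).length = 2 * g :=
    hO.length_filter_eq.trans hbal
  have hnz₁ : ∀ x ∈ A ++ (wv, false) :: (yv, true) :: C, x.1 ≠ 0 :=
    hO.ne_zero (stdSymp_int_self g) hnz
  have hspan₁ : Submodule.span ℚ ((fun (v : Fin g ⊕ Fin g → ℤ) (i : Fin g ⊕ Fin g) => (v i : ℚ)) ''
      letters (A ++ (wv, false) :: (yv, true) :: C)) = ⊤ :=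
    top_unique (hspan ▸ span_ratCast_mono
      (Submodule.subset_span.trans hO.span_letters_eq.symm.le))
  have hcosAC : classesOfSign (A ++ C) true = classesOfSign (X ++ Z) true := by
    rw [← classesOfSign_filter_true, hf, classesOfSign_filter_true]
  have hcosl : classesOfSign (X ++ (yv, true) :: Z) true = insert yv (classesOfSign (A ++ C) true) := by
    rw [hcosAC, classesOfSign_append, classesOfSign_append,
      classesOfSign_cons_of_eq (x := (yv, true)) rfl, Set.union_insert]
  -- the positive span `U` equals the span of the positive classes of `A ++ C`
  have hUeq : Submodule.span ℚ ((fun (v : Fin g ⊕ Fin g → ℤ) (i : Fin g ⊕ Fin g) => (v i : ℚ)) ''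
      classesOfSign (X ++ (yv, true) :: Z) true) = Submodule.span ℚ ((fun (v : Fin g ⊕ Fin g → ℤ)
        (i : Fin g ⊕ Fin g) => (v i : ℚ)) '' classesOfSign (A ++ C) true) := by
    rw [hcosl, Set.image_insert_eq]
    exact Submodule.span_insert_eq_span (hcosAC ▸ hyU)
  have hwU : (fun i => (wv i : ℚ)) ∉ Submodule.span ℚ ((fun (v : Fin g ⊕ Fin g → ℤ)
      (i : Fin g ⊕ Fin g) => (v i : ℚ)) '' classesOfSign (A ++ C) true) := by
    intro h
    rw [← hUeq] at h
    have e : (fun i => (u i : ℚ)) = (fun i => (wv i : ℚ)) - fun i => ((wv - u) i : ℚ) := by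
      ext i; simp
    exact huU (e ▸ sub_mem h (ratCast_mem_span hcl))
  have hwv : wv ≠ 0 := hnz₁ (wv, false) (by simp)
  have hyv : yv ≠ 0 := hnz₁ (yv, true) (by simp)
  -- (d) the arc class `c` and the exchange
  obtain ⟨c, hc, hcw, hcy⟩ := exists_isPrimitive_stdSymp_ne g hwv hyv
  have hwc : stdSymp ℤ g wv c ≠ 0 := by
    rw [stdSymp_int_swap]
    exact neg_ne_zero.2 hcw
  set L' : IntWord (g + 1) := mapWord (embed g) A ++
    (newE g + embed g c - stdSymp ℤ g wv c • embed g wv, true) :: (embed g wv, false) ::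
    (newF g, true) :: (newF g, false) ::
    (embed g yv - stdSymp ℤ g c yv • (newE g + embed g c), true) ::
    (newE g + embed g c, false) :: mapWord (embed g) C with hL'
  have hreach : Reach g (A ++ (wv, false) :: (yv, true) :: C) (g + 1) L' := by
    convert reach_exchange g A C (wv, false) (yv, true) c (Or.inr hc) using 2
    simp [sub_eq_add_neg]
  have hAsub : ∀ x ∈ mapWord (embed g) A, x ∈ L' := fun x hx => by rw [hL']; simp [hx]
  have hCsub : ∀ x ∈ mapWord (embed g) C, x ∈ L' := fun x hx => by rw [hL']; simp [hx]
  -- spans of the new word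
  have hS : ∀ x ∈ L', (fun i => (x.1 i : ℚ)) ∈ Submodule.span ℚ ((fun (v : Fin (g + 1) ⊕
      Fin (g + 1) → ℤ) (i : Fin (g + 1) ⊕ Fin (g + 1)) => (v i : ℚ)) '' letters L') :=
    fun x hx => Submodule.subset_span (Set.mem_image_of_mem _ (fst_mem_letters hx))
  have hP : ∀ x ∈ L', x.2 = true → (fun i => (x.1 i : ℚ)) ∈ Submodule.span ℚ ((fun (v : Fin (g + 1) ⊕
      Fin (g + 1) → ℤ) (i : Fin (g + 1) ⊕ Fin (g + 1)) => (v i : ℚ)) '' classesOfSign L' true) :=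
    fun x hx h2 => Submodule.subset_span (Set.mem_image_of_mem _ (mem_classesOfSign hx h2))
  -- the rational images of the three new positive classes and of `e`
  have hE := congrFun (ratCast_newE g)
  have e₁ : (Pi.single (Sum.inl (Fin.last g)) 1 : Fin (g + 1) ⊕ Fin (g + 1) → ℚ) +
      Function.ExtendByZero.linearMap ℚ (Sum.map (Fin.castSucc (n := g)) (Fin.castSucc (n := g)))
        (fun i => (c i : ℚ)) + (-(stdSymp ℤ g wv c : ℚ)) •
      Function.ExtendByZero.linearMap ℚ (Sum.map (Fin.castSucc (n := g)) (Fin.castSucc (n := g)))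
        (fun i => (wv i : ℚ)) =
      fun i => ((newE g + embed g c - stdSymp ℤ g wv c • embed g wv) i : ℚ) := by
    rw [extendQ_ratCast, extendQ_ratCast]
    ext i
    simp only [Pi.add_apply, Pi.smul_apply, Pi.sub_apply, smul_eq_mul, Int.cast_add,
      Int.cast_sub, Int.cast_mul, ← hE]
    ring
  have e₃ : Function.ExtendByZero.linearMap ℚ (Sum.map (Fin.castSucc (n := g))
        (Fin.castSucc (n := g))) (fun i => (yv i : ℚ)) - (stdSymp ℤ g c yv : ℚ) •
      ((Pi.single (Sum.inl (Fin.last g)) 1 : Fin (g + 1) ⊕ Fin (g + 1) → ℚ) +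
        Function.ExtendByZero.linearMap ℚ (Sum.map (Fin.castSucc (n := g)) (Fin.castSucc (n := g)))
          (fun i => (c i : ℚ))) =
      fun i => ((embed g yv - stdSymp ℤ g c yv • (newE g + embed g c)) i : ℚ) := by
    rw [extendQ_ratCast, extendQ_ratCast]
    ext i
    simp only [Pi.add_apply, Pi.smul_apply, Pi.sub_apply, smul_eq_mul, Int.cast_add,
      Int.cast_sub, Int.cast_mul, ← hE]
  have eE : (Pi.single (Sum.inl (Fin.last g)) 1 : Fin (g + 1) ⊕ Fin (g + 1) → ℚ) =
      (fun i => ((newE g + embed g c) i : ℚ)) -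
        Function.ExtendByZero.linearMap ℚ (Sum.map (Fin.castSucc (n := g)) (Fin.castSucc (n := g)))
          (fun i => (c i : ℚ)) := by
    rw [extendQ_ratCast]
    ext i
    simp [← hE]
  have eY : (fun i => (embed g yv i : ℚ)) =
      (fun i => ((embed g yv - stdSymp ℤ g c yv • (newE g + embed g c)) i : ℚ)) +
        (stdSymp ℤ g c yv : ℚ) • fun i => ((newE g + embed g c) i : ℚ) := by
    ext i
    simp only [Pi.add_apply, Pi.smul_apply, Pi.sub_apply, smul_eq_mul, Int.cast_add,
      Int.cast_sub, Int.cast_mul]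
    ring
  -- the old letters, embedded, lie in the span of the new letters
  have hrange : LinearMap.range (Function.ExtendByZero.linearMap ℚ
      (Sum.map (Fin.castSucc (n := g)) (Fin.castSucc (n := g)))) ≤ Submodule.span ℚ
        ((fun (v : Fin (g + 1) ⊕ Fin (g + 1) → ℤ) (i : Fin (g + 1) ⊕ Fin (g + 1)) => (v i : ℚ)) ''
          letters L') := by
    rw [LinearMap.range_eq_map, ← hspan₁, Submodule.map_span, Submodule.span_le]
    rintro _ ⟨_, ⟨v, ⟨s, hvs⟩, rfl⟩, rfl⟩
    dsimp only
    rw [SetLike.mem_coe, extendQ_ratCast]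
    simp only [List.mem_append, List.mem_cons, Prod.mk.injEq] at hvs
    rcases hvs with h | ⟨rfl, rfl⟩ | ⟨rfl, rfl⟩ | h
    · exact hS (embed g v, s) (hAsub _ (List.mem_map.2 ⟨(v, s), h, rfl⟩))
    · exact hS (embed g v, false) (by simp [hL'])
    · rw [eY]
      exact add_mem (hS (_, true) (by simp [hL'])) (Submodule.smul_mem _ _ (hS (_, false) (by simp [hL'])))
    · exact hS (embed g v, s) (hCsub _ (List.mem_map.2 ⟨(v, s), h, rfl⟩))
  refine ⟨L', (Reach.of_hurwitzOrbit hO).trans hreach, ?_, ?_, ?_, ?_, ?_⟩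
  · -- (f) length
    simp only [hL', List.length_append, List.length_cons, length_mapWord] at hlen₁ ⊢
    omega
  · -- number of positive letters
    simp [hL', length_filter_mapWord] at hbal₁ ⊢
    omega
  · -- non-vanishing of all classes
    have hemb : ∀ x ∈ A ++ (wv, false) :: (yv, true) :: C, embed g x.1 ≠ 0 := fun x hx h =>
      hnz₁ x hx (embed_injective g (h.trans (embed_zero g).symm))
    simp only [List.forall_mem_append, List.forall_mem_cons] at hemb
    obtain ⟨hA, hw', hy', hC⟩ := hemb
    simp only [hL', List.forall_mem_append, List.forall_mem_cons, mapWord, List.forall_mem_map]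
    refine ⟨hA, fun h => ?_, hw', fun h => ?_, fun h => ?_, fun h => ?_, fun h => ?_, hC⟩
    · simpa [newE] using congrFun h (Sum.inl (Fin.last g))
    · simpa [newF] using congrFun h (Sum.inr (Fin.last g))
    · simpa [newF] using congrFun h (Sum.inr (Fin.last g))
    · simpa [newE, hcy] using congrFun h (Sum.inl (Fin.last g))
    · simpa [newE] using congrFun h (Sum.inl (Fin.last g))
  · -- all classes span
    rw [letters_ratWord]
    refine eq_top_of_range_extendQ_le g _ hrange ?_ ?_
    · rw [eE]
      exact sub_mem (hS (_, false) (by simp [hL'])) (hrange (LinearMap.mem_range_self _ _))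
    · rw [← ratCast_newF]
      exact hS (newF g, true) (by simp [hL'])
  · -- (g) rank gain
    rw [classesOfSign_ratWord, hUeq]
    refine finrank_add_three_le g _ _ (fun i => (wv i : ℚ)) (fun i => (yv i : ℚ))
      (fun i => (c i : ℚ)) (-(stdSymp ℤ g wv c : ℚ)) (stdSymp ℤ g c yv : ℚ)
      (neg_ne_zero.2 (Int.cast_ne_zero.2 hwc)) (Int.cast_ne_zero.2 hcy) hwU (hcosAC ▸ hyU)
      ?_ ?_ ?_ ?_
    · rw [Submodule.map_span, Submodule.span_le]
      rintro _ ⟨_, ⟨v, hv, rfl⟩, rfl⟩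
      dsimp only
      rw [SetLike.mem_coe, extendQ_ratCast]
      refine hP (embed g v, true) ?_ rfl
      rcases List.mem_append.1 hv with h | h
      · exact hAsub _ (List.mem_map.2 ⟨(v, true), h, rfl⟩)
      · exact hCsub _ (List.mem_map.2 ⟨(v, true), h, rfl⟩)
    · rw [← ratCast_newF]
      exact hP (newF g, true) (by simp [hL']) rfl
    · rw [e₁]
      exact hP (_, true) (by simp [hL']) rfl
    · rw [e₃]
      exact hP (_, true) (by simp [hL']) rfl

end Exchange

/-- **Stub `stub_exchange` (the exchange engine).** An integral signed word of genus `g` with `4g`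
letters, `2g` of them positive, all classes non-zero and all classes spanning `ℚ^{2g}`, reaches —
by signed Hurwitz moves and stabilisation-pair moves (`Reach`) — a word of some genus `g'` with
`4g'` letters, `2g'` positive, whose positive classes span `ℚ^{2g'}`.  Proof: induction on the
corank of the span `U` of the positive classes; while `U ≠ ⊤`, `Exchange.exchange_step` (travel a
negative letter with class outside `U` next to a redundant positive letter, stabilise at the cut
with a primitive arc class linking both, tilt twice) raises the genus by `1` and `rank U` by at
least `3`, keeping all the invariants. [folklore] -/
theorem stub_exchange :
    ∀ (g : ℕ) (l : IntWord g),
      l.length = 4 * g → (l.filter (·.2)).length = 2 * g →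
      (∀ x ∈ l, x.1 ≠ 0) →
      Submodule.span ℚ (letters (ratWord l)) = ⊤ →
      ∃ (g' : ℕ) (l' : IntWord g'),
        Reach g l g' l' ∧ l'.length = 4 * g' ∧ (l'.filter (·.2)).length = 2 * g' ∧
        Submodule.span ℚ (classesOfSign (ratWord l') true) = ⊤ := by
  suffices h : ∀ (n g : ℕ) (l : IntWord g),
      2 * g ≤ Module.finrank ℚ (Submodule.span ℚ (classesOfSign (ratWord l) true)) + n →
      l.length = 4 * g → (l.filter (·.2)).length = 2 * g → (∀ x ∈ l, x.1 ≠ 0) →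
      Submodule.span ℚ (letters (ratWord l)) = ⊤ →
      ∃ (g' : ℕ) (l' : IntWord g'),
        Reach g l g' l' ∧ l'.length = 4 * g' ∧ (l'.filter (·.2)).length = 2 * g' ∧
        Submodule.span ℚ (classesOfSign (ratWord l') true) = ⊤ by
    intro g l hlen hbal hnz hspan
    exact h (2 * g) g l (by omega) hlen hbal hnz hspan
  intro n
  induction n with
  | zero =>
    intro g l hk hlen hbal _ _
    refine ⟨g, l, Reach.refl g l, hlen, hbal,
      Submodule.eq_top_of_finrank_eq (le_antisymm (Submodule.finrank_le _) ?_)⟩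
    rw [Exchange.finrank_eq]
    omega
  | succ n ih =>
    intro g l hk hlen hbal hnz hspan
    by_cases hU : Submodule.span ℚ (classesOfSign (ratWord l) true) = ⊤
    · exact ⟨g, l, Reach.refl g l, hlen, hbal, hU⟩
    · obtain ⟨l', hreach, hlen', hbal', hnz', hspan', hrk⟩ :=
        Exchange.exchange_step l hlen hbal hnz hspan hU
      obtain ⟨g'', l'', hreach', hlen'', hbal'', htop⟩ :=
        ih (g + 1) l' (by omega) hlen' hbal' hnz' hspan'
      exact ⟨g'', l'', hreach.trans hreach', hlen'', hbal'', htop⟩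

end Summit.SmoothPoincare4.SmoothPoincare4.Theorems.AcyclicBisectionExists.ModpBraidOrbits

end
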